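import Summits.BirchSwinnertonDyer.BirchSwinnertonDyer.Theorems.TwoAdicConverseMultiplicativeInputs
import Summits.BirchSwinnertonDyer.Rank1Residual.X5.TwoAdicTargetsMultEisenstein
import HarnessLib

/-!
# Route `TwoAdicConverse`, multiplicative node: the crux `MultiplicativeRankZeroTwoConverse`
# (stmt-BirchSwinnertonDyer-19219) from the SAME ∀-closed typed object as the K4ᵐ lower half
# (stmt-BirchSwinnertonDyer-19923) — the integral Eisenstein direction at a multiplicative `2`,
# `X5.O1.MultEisensteinDivisibilityAtTwo` (T-mult-4-int)

WHAT IS PROVED (seat bsd-2adic-conv-2, D-0074 (A) «find: 19219 MultiplicativeRankZeroTwoConverse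
likewise»; THEOREMS ONLY — no definition, no named fact, nothing asserted). The good-ordinary design
of the cell (seat bsd-2adic-ord, v1.3 FIX B) types ONE rank-free object, the Eisenstein half
`OrdEisensteinHalfAtTwo := ∀ non-CM W good-ordinary at 2, X5.O1.MainConjectureEisensteinDivisibilityAtTwo W`,
and lets it serve BOTH the formula crux (K4ᵒ lower half, `MissingLowerBoundAt W 2` at `r_an = 0`) and
the rank-`0` 2-converse (S3ᵒ, `GoodOrdinaryRankZeroTwoConverse`). This file is the multiplicative
«likewise»: seat bsd-2adic-mult-3 typed the integral Eisenstein direction at a MULTIPLICATIVE `2`,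
`X5.O1.MultEisensteinDivisibilityAtTwo W` (T-mult-4-int, `X5/TwoAdicTargetsMultEisenstein.lean`:
`ι f_X = ι h · (ϖ·L₂)` non-split, `ι(T·f_X) = ι h · (ϖ·L₂)` split; Néron normalisation `ϖ·Ω_E = Ω⁺_f`),
and proved that it delivers the K4ᵐ lower half `MissingLowerBoundAt W 2` on «r_an = 0, multiplicative at
2» (`X5/TwoAdicTargetsMultEisensteinLower.lean`). HERE: the same object delivers the rank-`0`
2-CONVERSE at a multiplicative `2`:
* `analyticRank_eq_zero_of_finite_selmer_nonsplit_two_of_multEisenstein` — non-split `2`: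
  `Sel_{2^∞}(E/ℚ)` finite ⇒ `L(E,1) ≠ 0 ∧ r_an(E) = 0` ⟸ PRINT {Greenberg's non-split display A235
  (`h41`), modularity (`hmod`, which also supplies the rational period ratio `ϖ = Ω⁺_f/Ω_E`,
  Edixhoven)} + «`X(E/ℚ_∞)` is `Λ`-torsion» (`hX`; K11 / PROOF-MULT) + T-mult-4-int at `W`. Chain:
  `Sel` finite ⇒ (A235) `f_X(0) ≠ 0`; `f_X(0) = h(0)·ϖ·L₂(0) = h(0)·ϖ·2·[0]⁺_f` ⇒ `[0]⁺_f ≠ 0` ⇒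
  `L(E,1) = [0]⁺_f·Ω⁺_f ≠ 0`.
* `analyticRank_eq_zero_of_finite_selmer_split_two_of_multEisenstein` — split `2`: the same ⟸
  PRINT {A236 (`h41`), modularity, Mahler–Manin (`𝓛₂(E) ≠ 0`, inside)} + `hX` + T-mult-4-int +
  Greenberg–Stevens at `2` (`hGS`, memo PROOF-GS2, referee RC-4 PASS): `f_X(0) = [T¹]ι(T·f_X) =
  h(0)·ϖ·[T¹]L₂` (`L₂(0) = 0`) ⇒ `[T¹]L₂ ≠ 0` ⇒ (GS) `𝓛₂(E)·[0]⁺_f ≠ 0`.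
* `multiplicativeRankZeroTwoConverse_of_multEisenstein` — the ∀-closed BRIDGE: PRINT {A235, A236,
  modularity} + MEMO {K11 `X5.O1.KatoMultiplicativeDivisibilityRat W 2` ∀ non-CM mult-at-2 (used ONLY
  for «`X` torsion»), `greenberg_stevens W 2` ∀ split-at-2} + the ONE research object
  `∀ non-CM W multiplicative at 2, X5.O1.MultEisensteinDivisibilityAtTwo W` ⇒
  `MultiplicativeRankZeroTwoConverse`. No `μ`, no period integrality, no `BSD₂`, no upper half, no
  twist, no auxiliary field.
CONSEQUENCE (for the planner): S3ᵐ (19219) and K4ᵐ-lower (19923) hinge on the SAME typed ∀-object,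
exactly as S3ᵒ (19218) and K4ᵒ-lower do on `OrdEisensteinHalfAtTwo`; a re-split of 19219 over the
cyclotomic road «PUB/MEMO bundle + MultEisensteinHalfAtTwo» is glued by
`multiplicativeRankZeroTwoConverse_of_multEisenstein` in one line. The object is NOT in print at
`p = 2` (Skinner 2016 Thm. A/B `p ≥ 3`; Skinner–Urban 2014 `p` odd, `p ∤ N`; BCS 2024/25 `p > 3`).
PARTITION: none — RANK axis (S3 mult); companion formula cell X5@2 mult (K4ᵐ, B1·O1; 1 976 classes).
[cite: GreenbergLNM1716, §4 pp. 112–113] [cite: MazurTateTeitelbaum1986Invent, §I.14]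
[cite: Skinner2016PacificMC, Thm. A and Thm. B (§1; p ≥ 3; shape only)] [cite: EdixhovenManin1991, §1]
-/

set_option autoImplicit false
set_option linter.dupNamespace false

noncomputable section

open scoped Classical MatrixGroups ModularForm

open CongruenceSubgroup WeierstrassCurve Literature.NumberTheory.EllipticCurves
  Literature.NumberTheory.EllipticCurves.ModularForms
  Literature.NumberTheory.EllipticCurves.Greenberg1999
  Literature.NumberTheory.EllipticCurves.Rank1Residual
  Literature.NumberTheory.EllipticCurves.Rank1Residual.Typed
  Summit.BirchSwinnertonDyer.Rank1Residual.X5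
  Summit.BirchSwinnertonDyer.Rank1Residual.X5.O1

namespace Summit.BirchSwinnertonDyer.BirchSwinnertonDyer.Theorems

section PerCurve

variable (W : WeierstrassCurve ℚ) [W.IsElliptic] [W.IsGloballyMinimal]

/-- **Rank-`0` `2`-converse at a NON-SPLIT multiplicative `2` from T-mult-4-int (PROVED modulo the
displayed inputs).** `E/ℚ` (globally minimal `W`) non-split multiplicative at `2`; inputs: Greenberg's
non-split display at `2` (`h41`, A235, PRINT), modularity (`hmod`, PRINT — it also supplies the
rational period ratio `ϖ`, `ϖ·Ω_E = Ω⁺_f`), «`X(E/ℚ_∞)` is `Λ`-torsion for every cyclotomic dual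
datum» (`hX`, K11 / PROOF-MULT Thm. A), and the integral Eisenstein direction
`O1.MultEisensteinDivisibilityAtTwo W` (`hEis`, T-mult-4-int, OPEN). If `Sel_{2^∞}(E/ℚ)` is finite then
`L(E,1) ≠ 0` and `r_an(E) = 0`: A235 gives `f_X(0) ≠ 0`, T-mult-4-int gives
`f_X(0) = h(0)·ϖ·(2·[0]⁺_f)`, so `[0]⁺_f ≠ 0`, i.e. `L(E,1) = [0]⁺_f·Ω⁺_f ≠ 0`.
[cite: GreenbergLNM1716, §4 pp. 112–113]
[cite: MazurTateTeitelbaum1986Invent, §I.14 (L(0) = (1 − α⁻¹)[0]⁺, α = −1)] -/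
theorem analyticRank_eq_zero_of_finite_selmer_nonsplit_two_of_multEisenstein
    (h41 : thm41Analogue_charValue_rankZero_numberField_anyPrime)
    (hmod : nonempty_modularParametrizationData)
    (hX : ∀ (κ : ZpExtension ℚ 2) (γ : Field.absoluteGaloisGroup ℚ), κ.IsCyclotomic →
      κ.IsTopGenerator γ → IsCyclotomicVariable 2 γ → ∀ D : W.SelmerDualData κ γ, D.IsTorsion)
    (hEis : MultEisensteinDivisibilityAtTwo W)
    (hmult : Mult W 2) (hns : ¬ W.HasSplitMultiplicativeReductionAtPrime 2)
    (hfin : Finite (W.selmerGroupPInfty 2)) :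
    W.entireLFunction 1 ≠ 0 ∧ W.analyticRank = 0 := by
  haveI : NeZero (W.conductorNorm ℤ) := ⟨(W.conductorNorm_pos_holds).ne'⟩
  obtain ⟨Dm⟩ := hmod W
  have hf : IsNewformOf W Dm.f := Dm.isNewformOf
  obtain ⟨ϖ, hϖpos, hϖ, -⟩ := Dm.exists_rat_mul_realPeriodRat_eq_plusPeriod
  obtain ⟨κ, hκ, γ, hγ, hγ'⟩ := exists_isCyclotomic_isTopGenerator_isCyclotomicVariable_holds 2
  obtain ⟨D⟩ := W.nonempty_selmerDualData_holds κ γ hγ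
  obtain ⟨L, hL⟩ := exists_isMultPAdicLFunctionOf_neg_one_of_nonsplit (p := 2) hf hmult hns
  have hXD : D.IsTorsion := hX κ γ hκ hγ hγ' D
  haveI : Module.Finite (IwasawaAlgebra 2) D.X := D.module_finite_holds hγ
  haveI : (Module.charIdeal (IwasawaAlgebra 2) D.X).IsPrincipal := charIdeal_isPrincipal_holds 2 D.X
  obtain ⟨fE, hchar⟩ := Submodule.IsPrincipal.principal (Module.charIdeal (IwasawaAlgebra 2) D.X)
  have hchar' : D.charIdeal = Ideal.span {fE} := hchar
  -- Greenberg's non-split display at `2` (A235): `f_E(0) ≠ 0` since `Sel` is finite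
  have hEC : TwoAdicEulerCharRankZeroNonsplitMult W 0 :=
    twoAdicEulerCharRankZeroNonsplitMult_zero_of_greenberg W h41
  obtain ⟨u, hu⟩ := hEC hmult hns κ γ hκ hγ hγ' D hXD fE hchar' hfin
  have hcard : (Nat.card (W.selmerGroupPInfty 2) : ℚ_[2]) ≠ 0 := by
    haveI := hfin
    exact_mod_cast (Nat.card_pos (α := W.selmerGroupPInfty 2)).ne'
  have hfE0 : ((PowerSeries.constantCoeff fE : ℤ_[2]) : ℚ_[2]) ≠ 0 := by
    intro h0
    rw [h0, zero_mul] at hu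
    exact (mul_ne_zero (mul_ne_zero (coe_units_ne_zero 2 u) (zpow_ne_zero _ two_ne_zero)) hcard)
      hu.symm
  -- T-mult-4-int, non-split clause at `(Dm.f, ϖ)`: `ι f_E = ι h · (ϖ · L)`, constant coefficients
  obtain ⟨hns', -⟩ := hEis κ γ hκ hγ hγ' hmult Dm.f hf ϖ hϖ D fE hchar'
  obtain ⟨h, hdiv⟩ := hns' hns L hL
  have h0 := congrArg PowerSeries.constantCoeff hdiv
  rw [map_mul, map_mul, PowerSeries.constantCoeff_C, constantCoeff_iwasawaToPowerSeries,
    constantCoeff_iwasawaToPowerSeries, hL.constantCoeff_of_neg_one] at h0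
  -- `f_E(0) = h(0) · (ϖ · (2 · [0]⁺_f))`, so `[0]⁺_f ≠ 0`
  have hs0 : (ratPlusSymbol Dm.f 0 : ℚ_[2]) ≠ 0 := by
    intro hz
    rw [hz, mul_zero, mul_zero, mul_zero] at h0
    exact hfE0 h0
  have hs0' : ratPlusSymbol Dm.f 0 ≠ 0 := by exact_mod_cast hs0
  have hL1 : W.entireLFunction 1 ≠ 0 := (ratPlusSymbol_zero_ne_zero_iff W hf).mp hs0'
  exact ⟨hL1, (W.analyticRank_eq_zero_iff_holds hf.hasEntireLFunction).mpr hL1⟩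

/-- **Rank-`0` `2`-converse at a SPLIT multiplicative `2` from T-mult-4-int (PROVED modulo the
displayed inputs and the memo-proved `greenberg_stevens W 2`).** Inputs: Greenberg's split display at
`2` (`h41`, A236, PRINT), modularity (with the rational `ϖ`), Mahler–Manin (`𝓛₂(E) ≠ 0`, inside),
«`X` torsion» (`hX`, K11b / PROOF-MULT Thm. B), T-mult-4-int (`hEis`), and the exceptional-zero
formula `greenberg_stevens W 2` (`hGS`, PROOF-GS2). If `Sel_{2^∞}(E/ℚ)` is finite then `L(E,1) ≠ 0`
and `r_an(E) = 0`: A236 gives `f_X(0) ≠ 0`; T-mult-4-int (coefficient of `T¹`, `L₂(0) = 0`) gives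
`f_X(0) = h(0)·ϖ·[T¹]L₂`, so `[T¹]L₂ ≠ 0`, and GS at `2` (`[T¹]L₂·log₂ γ = 𝓛₂(E)·[0]⁺_f`) gives
`[0]⁺_f ≠ 0`. [cite: GreenbergLNM1716, §4 pp. 112–113] [cite: MazurTateTeitelbaum1986Invent, §II.10]
[cite: Kobayashi2006DocMath, Cor. 4.2 (shape; odd p)] -/
theorem analyticRank_eq_zero_of_finite_selmer_split_two_of_multEisenstein
    (hGS : greenberg_stevens (W := W) (p := 2))
    (h41 : thm41Analogue_charValue_rankZero_split_baseChange_anyPrime)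
    (hmod : nonempty_modularParametrizationData)
    (hX : ∀ (κ : ZpExtension ℚ 2) (γ : Field.absoluteGaloisGroup ℚ), κ.IsCyclotomic →
      κ.IsTopGenerator γ → IsCyclotomicVariable 2 γ → ∀ D : W.SelmerDualData κ γ, D.IsTorsion)
    (hEis : MultEisensteinDivisibilityAtTwo W)
    (hmult : Mult W 2) (hsp : W.HasSplitMultiplicativeReductionAtPrime 2)
    (hfin : Finite (W.selmerGroupPInfty 2)) :
    W.entireLFunction 1 ≠ 0 ∧ W.analyticRank = 0 := by
  haveI : NeZero (W.conductorNorm ℤ) := ⟨(W.conductorNorm_pos_holds).ne'⟩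
  obtain ⟨Dm⟩ := hmod W
  have hf : IsNewformOf W Dm.f := Dm.isNewformOf
  obtain ⟨ϖ, hϖpos, hϖ, -⟩ := Dm.exists_rat_mul_realPeriodRat_eq_plusPeriod
  obtain ⟨κ, hκ, γ, hγ, hγ'⟩ := exists_isCyclotomic_isTopGenerator_isCyclotomicVariable_holds 2
  obtain ⟨D⟩ := W.nonempty_selmerDualData_holds κ γ hγ
  obtain ⟨L, hL⟩ := exists_isSplitMultPAdicLFunctionOf hsp hf
  obtain ⟨Dq⟩ := (nonempty_tateParameterData_iff_holds (W := W) (p := 2)).mpr hsp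
  have hlog : padicLog 2 Dq.q ≠ 0 :=
    Dq.padicLog_q_ne_zero Literature.NumberTheory.Transcendental.MahlerManinPadic_holds
  have hXD : D.IsTorsion := hX κ γ hκ hγ hγ' D
  haveI : Module.Finite (IwasawaAlgebra 2) D.X := D.module_finite_holds hγ
  haveI : (Module.charIdeal (IwasawaAlgebra 2) D.X).IsPrincipal := charIdeal_isPrincipal_holds 2 D.X
  obtain ⟨fE, hchar⟩ := Submodule.IsPrincipal.principal (Module.charIdeal (IwasawaAlgebra 2) D.X)
  have hchar' : D.charIdeal = Ideal.span {fE} := hchar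
  -- Greenberg's split display at `2` (A236): `f_E(0) ≠ 0` since `Sel` is finite
  have hEC : TwoAdicEulerCharRankZeroSplitMult W 0 :=
    twoAdicEulerCharRankZeroSplitMult_zero_of_greenberg W h41
  obtain ⟨u, hu⟩ := hEC hmult hsp κ γ hκ hγ hγ' D hXD fE hchar' hfin Dq hlog
  have hcard : (Nat.card (W.selmerGroupPInfty 2) : ℚ_[2]) ≠ 0 := by
    haveI := hfin
    exact_mod_cast (Nat.card_pos (α := W.selmerGroupPInfty 2)).ne'
  have hLI0 : LInvariant Dq ≠ 0 := lInvariant_two_ne_zero W Dq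
  have hfE0 : ((PowerSeries.constantCoeff fE : ℤ_[2]) : ℚ_[2]) ≠ 0 := by
    intro h0
    rw [h0, zero_mul] at hu
    refine (mul_ne_zero (mul_ne_zero (mul_ne_zero (coe_units_ne_zero 2 u) ?_)
      (zpow_ne_zero _ two_ne_zero)) hcard) hu.symm
    exact div_ne_zero hLI0 (by norm_num)
  -- T-mult-4-int, split clause at `(Dm.f, ϖ)`: `ι(T · f_E) = ι h · (ϖ · L)`; coefficient of `T¹`
  obtain ⟨-, hsp'⟩ := hEis κ γ hκ hγ hγ' hmult Dm.f hf ϖ hϖ D fE hchar'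
  obtain ⟨h, hdiv⟩ := hsp' hsp L hL
  have h1 := congrArg (PowerSeries.coeff 1) hdiv
  rw [coeff_one_iwasawaToPowerSeries_X_mul, ← mul_assoc, PowerSeries.coeff_mul,
    Finset.Nat.sum_antidiagonal_eq_sum_range_succ_mk, Finset.sum_range_succ,
    Finset.sum_range_succ, Finset.sum_range_zero, zero_add,
    PowerSeries.coeff_zero_eq_constantCoeff_apply L, hL.constantCoeff_eq_zero, mul_zero, add_zero,
    PowerSeries.coeff_zero_eq_constantCoeff_apply, map_mul, PowerSeries.constantCoeff_C,
    constantCoeff_iwasawaToPowerSeries] at h1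
  -- `f_E(0) = h(0) · ϖ · [T¹]L`, so `[T¹]L ≠ 0`
  have hc1 : PowerSeries.coeff 1 L ≠ 0 := by
    intro hz
    rw [hz, mul_zero] at h1
    exact hfE0 h1
  -- Greenberg–Stevens at `2`: `[T¹]L · log₂ γ = 𝓛₂(E) · [0]⁺_f`, so `[0]⁺_f ≠ 0`
  obtain ⟨-, hGS1⟩ := hGS Dq hf hL
  have hs0 : (ratPlusSymbol Dm.f 0 : ℚ_[2]) ≠ 0 := by
    intro hz
    rw [hz, mul_zero] at hGS1
    exact (mul_ne_zero hc1 padicLog_cyclotomicGenerator_two_ne_zero) hGS1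
  have hs0' : ratPlusSymbol Dm.f 0 ≠ 0 := by exact_mod_cast hs0
  have hL1 : W.entireLFunction 1 ≠ 0 := (ratPlusSymbol_zero_ne_zero_iff W hf).mp hs0'
  exact ⟨hL1, (W.analyticRank_eq_zero_iff_holds hf.hasEntireLFunction).mpr hL1⟩

omit [W.IsElliptic] in
/-- «`X(E/ℚ_∞)` is `Λ`-torsion» from K11 at `W` (the first clause of
`O1.KatoMultiplicativeDivisibilityRat W 2`, read at the newform supplied by modularity). Bookkeeping.
[cite: Kato2004Asterisque, Thm 17.4 (1) and 17.13] -/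
theorem isTorsion_of_katoMultiplicativeDivisibilityRat [W.IsElliptic]
    (hmod : nonempty_modularParametrizationData)
    (hKato : KatoMultiplicativeDivisibilityRat W 2) (hmult : Mult W 2) :
    ∀ (κ : ZpExtension ℚ 2) (γ : Field.absoluteGaloisGroup ℚ), κ.IsCyclotomic →
      κ.IsTopGenerator γ → IsCyclotomicVariable 2 γ → ∀ D : W.SelmerDualData κ γ, D.IsTorsion := by
  intro κ γ hκ hγ hγ' D
  haveI : NeZero (W.conductorNorm ℤ) := ⟨(W.conductorNorm_pos_holds).ne'⟩
  obtain ⟨Dm⟩ := hmod W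
  exact (hKato κ γ hκ hγ hγ' hmult Dm.f Dm.isNewformOf D).1

end PerCurve

/-! ## The ∀-closed bridge: ONE research object, shared with the K4ᵐ lower half -/

/-- **Bridge (integral cyclotomic road ⇒ crux, item stmt-BirchSwinnertonDyer-19219).** PRINT
{A235 `h41ns`, A236 `h41sp`, modularity `hmod`} + MEMO {K11 `hKato` — Kato `⊗ℚ` at a multiplicative
`2`, ∀-closed over non-CM `E` multiplicative at `2`, used ONLY for «`X` torsion» (PROOF-MULT, referee
RC-2 PASS); Greenberg–Stevens at `2` `hGS` (PROOF-GS2, RC-4 PASS, split case)} + the ONE ∀-closed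
research object `hEis : ∀ non-CM W multiplicative at 2, X5.O1.MultEisensteinDivisibilityAtTwo W`
(T-mult-4-int — THE SAME object that gives the K4ᵐ lower half 19923 via
`X5.O1.missingLowerBoundAt_two_of_multEisenstein`) imply `MultiplicativeRankZeroTwoConverse`:
`corank Sel_{2^∞}(E/ℚ) = 0` ⇒ `Sel` finite (`finite_selmerGroupPInfty_iff_selmerCorank_eq_zero`) ⇒
`r_an(E) = 0` by the two per-curve theorems above. The multiplicative twin of
`goodOrdinaryRankZeroTwoConverse_of_facts_of_eisenstein` (p409493). Nothing asserted.
[cite: GreenbergLNM1716, §4 pp. 112–113] [cite: MazurTateTeitelbaum1986Invent, §I.14]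
[cite: Kato2004Asterisque, Thm 17.4 and 17.13] -/
theorem multiplicativeRankZeroTwoConverse_of_multEisenstein
    (h41ns : thm41Analogue_charValue_rankZero_numberField_anyPrime)
    (h41sp : thm41Analogue_charValue_rankZero_split_baseChange_anyPrime)
    (hmod : nonempty_modularParametrizationData)
    (hKato : ∀ (W : WeierstrassCurve ℚ) [W.IsElliptic] [W.IsGloballyMinimal],
      ¬ W.HasCM → Mult W 2 → KatoMultiplicativeDivisibilityRat W 2)
    (hGS : ∀ (W : WeierstrassCurve ℚ) [W.IsElliptic] [W.IsGloballyMinimal],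
      W.HasSplitMultiplicativeReductionAtPrime 2 → greenberg_stevens (W := W) (p := 2))
    (hEis : ∀ (W : WeierstrassCurve ℚ) [W.IsElliptic] [W.IsGloballyMinimal],
      ¬ W.HasCM → Mult W 2 → MultEisensteinDivisibilityAtTwo W) :
    Summit.BirchSwinnertonDyer.BirchSwinnertonDyer.Theses.TwoAdicConverse.MultiplicativeRankZeroTwoConverse := by
  unfold Summit.BirchSwinnertonDyer.BirchSwinnertonDyer.Theses.TwoAdicConverse.MultiplicativeRankZeroTwoConverse
  intro W _ _ hcm hmult hsel
  haveI : Fact (Nat.Prime 2) := ⟨Nat.prime_two⟩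
  have hfin : Finite (W.selmerGroupPInfty 2) :=
    (finite_selmerGroupPInfty_iff_selmerCorank_eq_zero W 2).mpr hsel
  have hX := isTorsion_of_katoMultiplicativeDivisibilityRat W hmod (hKato W hcm hmult) hmult
  by_cases hsp : W.HasSplitMultiplicativeReductionAtPrime 2
  · exact (analyticRank_eq_zero_of_finite_selmer_split_two_of_multEisenstein W (hGS W hsp) h41sp
      hmod hX (hEis W hcm hmult) hmult hsp hfin).2
  · exact (analyticRank_eq_zero_of_finite_selmer_nonsplit_two_of_multEisenstein W h41ns hmod hX
      (hEis W hcm hmult) hmult hsp hfin).2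

end Summit.BirchSwinnertonDyer.BirchSwinnertonDyer.Theorems

end
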